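import Literature.MathematicalPhysics.QuantumFieldTheory.Balaban1983to89.B5AverageCurlStokes

/-!
# T⁴ programme, spine node NE2 (U1a), lane P2 — LEAF FED⁺ OF THE VARIATIONAL ROUTE: THE COVARIANT FEDERBUSH INEQUALITY,
# ADDITIVE FORM, for the charged scalar (U(1) background = King's model), one block step, every torus
# (`t4/skeletons/NE2-t4-ne2-p2.md` v0.5 §2.C; cell `pub-balaban`, row NE2 co-owner #2, lineage t4-ne2-p2 gen 10)

HONEST FRAMING (T4-DAG p. 1).  Rung (B)+1 only — NOT infinite volume, NOT a mass gap, NOT Clay.  Node NE2 (η-rate of the linear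
theory) is NOT IN PRINT and NOT proved here.  MODEL LEVEL: the transporters are DATA (U(1) phases on bonds, `‖R‖ ≤ 1`; site transports
`T′`, `‖T′‖ ≤ 1`); lattice units; scalar (0-form) sector; one block step of side `L` from the torus `fine L N` to the torus `N`.  What is
proved is OURS and elementary (telescoping + Cauchy–Schwarz + the block bijection); nothing printed is a hypothesis; no `def … : Prop`
fact; no `sorry`; axioms standard.  HONEST DEPENDENCY (cell, verbatim): continuum YM on T⁴ ⇐ BetaPertH ∧ nine spine estimates (0/9 proved);
BetaPertH ⇐ (D1) ∧ (D4) ∧ CAP+tail; G-an2-4 gates asym, D1 and NE2/3/4.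

THE STATEMENT (leaf FED⁺, skeleton §2.C).  Coarse torus `Tor N`, fine torus `Tor (fine L N)` with blocks `B(y) = {bpt L N y j}`
([Balaban1984PropagatorsI] (1.6); tree `B5Block118.bpt`), coarse bond phases `R̄ : Tor N → Fin d → ℂ`, fine bond phases `R′`, site
transports `T′ : Tor (fine L N) → ℂ` (the contour variables of the transported average, [Balaban1985BackgroundPropagators] (3.19) p.393
«(Q′(V)λ)(y) = Σ_{x∈B(y)} L^{−d}R(V(Γ_{y,x}))λ(x)» — SHAPE only, here abelian), covariant difference `(D_R f)(y,μ) = R(y,μ)f(y+e_μ) − f(y)`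
((3.3) p.390, shape), transported average `(Q_{T′}f′)(y) = L^{−d}Σ_j T′(bpt y j)·f′(bpt y j)`, straight transporter `Π_t(x′,μ) =
R′(x′,μ)R′(x′+e_μ,μ)⋯` and the ONE-BLOCK TRANSPORT MISMATCH `Mis(y,μ,j) = R̄(y,μ)·T′(bpt (y+e_μ) j) − T′(bpt y j)·Π_L(bpt y j,μ)`.  Then for
EVERY fine field `f′` and every direction `μ`, with `X_μ = Σ_{x′}|(D_{R′}f′)(x′,μ)|²`, `Y = Σ_{x′}|f′(x′)|²` and `sup|Mis| ≤ m`: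

  `Σ_y |(D_{R̄} Q_{T′}f′)(y,μ)|² ≤ ( √(L²·X_μ/L^d) + m·√(Y/L^d) )²`      (`dirU_Qc_le`)

— the main term with constant EXACTLY 1 (at `m = 0` this is «averaging decreases the action» for the scalar Dirichlet form, the
0-form analogue of [Federbush1986PhaseCellI] (0.12) p.321 / tree `B5AverageCurlStokes`), the background entering ONLY through the
mismatch `m`, LINEARLY inside the square (additive defect `2m√(…)√(…) + m²Y/L^d`).  In physical units at level `n = L^k` (prefactor
`n^{2−d}`) this reads `Sc(Q_{T′}f′) ≤ (√Sf(f′) + √d·(n·m)·‖f′‖_{L²})²`; for the unit-scale-smooth class `m ≍ |F|·n⁻²`, so the defect is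
`O(|F|²n⁻²)·‖f′‖²` — rate `L^{−2k}` with NO node NE3 and NO propagator localisation (skeleton §2.B/§2.C).  The RELATIVE form
`Sc(Q f′) ≤ (1+μ)Sf(f′)` is FALSE whenever `m > 0` meets a flat `f′` (skeleton §2.B witness); this file is the correct replacement.
-/

noncomputable section

namespace Summit.QuantumFields.BalabanUV.T4Continuum.VariationalCovariantFederbush

open Finset
open Literature.MathematicalPhysics.QuantumFieldTheory.Balaban1983to89
open Literature.MathematicalPhysics.QuantumFieldTheory.Balaban1983to89.B5Prop11Plancherel (Tor fine unitVec)
open Literature.MathematicalPhysics.QuantumFieldTheory.Balaban1983to89.B5Block118 (tstep tstep_zero tstep_succ bpt bpt_add_tstep)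
open Literature.MathematicalPhysics.QuantumFieldTheory.Balaban1983to89.B5AverageCurlStokes (sum_translate sum_blocks_real)

variable {d : ℕ}

/-! ## §1 Objects: covariant difference, transported block average, straight transporter, mismatch -/

section Defs

variable (N : Fin d → ℕ) [∀ μ, NeZero (N μ)]

/-- the covariant forward difference `(D_R f)(y,μ) = R(y,μ)·f(y + e_μ) − f(y)` (U(1) phases; lattice units).
[cite: Balaban1985BackgroundPropagators, (3.3) p.390 (shape; abelian special case)] [folklore] -/
def cD (R : Tor N → Fin d → ℂ) (f : Tor N → ℂ) (y : Tor N) (μ : Fin d) : ℂ := R y μ * f (y + unitVec N μ) - f y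

/-- the covariant Dirichlet sum in direction `μ`: `Σ_y |(D_R f)(y,μ)|²`. [folklore] -/
def dirU (R : Tor N → Fin d → ℂ) (f : Tor N → ℂ) (μ : Fin d) : ℝ := ∑ y, ‖cD N R f y μ‖ ^ 2

/-- the Dirichlet sum is nonnegative. [folklore] -/
theorem dirU_nonneg (R : Tor N → Fin d → ℂ) (f : Tor N → ℂ) (μ : Fin d) : 0 ≤ dirU N R f μ :=
  sum_nonneg fun _ _ => by positivity

end Defs

section FineDefs

variable (L : ℕ) [NeZero L] (N : Fin d → ℕ) [∀ μ, NeZero (N μ)]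

/-- the TRANSPORTED block average `(Q_{T′} f′)(y) = L^{−d} Σ_j T′(bpt y j)·f′(bpt y j)`.
[cite: Balaban1985BackgroundPropagators, (3.19) p.393 (shape; abelian, site transports as data)] [folklore] -/
def Qc (T' : Tor (fine L N) → ℂ) (f' : Tor (fine L N) → ℂ) (y : Tor N) : ℂ :=
  ((L : ℂ) ^ d)⁻¹ * ∑ j : Fin d → Fin L, T' (bpt L N y j) * f' (bpt L N y j)

/-- the straight path transporter of `t` fine bonds from `x′` in direction `μ`: `Π_0 = 1`, `Π_{t+1} = Π_t·R′(x′ + t e_μ, μ)`. [folklore] -/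
def piT (R' : Tor (fine L N) → Fin d → ℂ) (x : Tor (fine L N)) (μ : Fin d) : ℕ → ℂ
  | 0 => 1
  | t + 1 => piT R' x μ t * R' (x + tstep (fine L N) μ t) μ

/-- the ONE-BLOCK TRANSPORT MISMATCH seen from the base point `j`:
`Mis(y,μ,j) = R̄(y,μ)·T′(bpt (y+e_μ) j) − T′(bpt y j)·Π_L(bpt y j, μ)` (zero iff the coarse transporter equals the `T′`-conjugated
straight fine holonomy from that base point). [folklore] -/
def mis (Rc : Tor N → Fin d → ℂ) (R' : Tor (fine L N) → Fin d → ℂ) (T' : Tor (fine L N) → ℂ) (y : Tor N) (μ : Fin d)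
    (j : Fin d → Fin L) : ℂ :=
  Rc y μ * T' (bpt L N (y + unitVec N μ) j) - T' (bpt L N y j) * piT L N R' (bpt L N y j) μ L

end FineDefs

/-! ## §2 Covariant telescoping along a straight fine path -/

section Telescope

variable (L : ℕ) [NeZero L] (N : Fin d → ℕ) [∀ μ, NeZero (N μ)]

omit [NeZero L] [∀ μ, NeZero (N μ)] in
/-- `Π_t·f′(x′ + t e_μ) − f′(x′) = Σ_{s<t} Π_s·(D_{R′}f′)(x′ + s e_μ, μ)`. [folklore] -/
theorem piT_telescope (R' : Tor (fine L N) → Fin d → ℂ) (f' : Tor (fine L N) → ℂ) (x : Tor (fine L N)) (μ : Fin d) (t : ℕ) :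
    piT L N R' x μ t * f' (x + tstep (fine L N) μ t) - f' x
      = ∑ s ∈ range t, piT L N R' x μ s * cD (fine L N) R' f' (x + tstep (fine L N) μ s) μ := by
  induction t with
  | zero => simp [piT, tstep_zero]
  | succ t ih =>
    rw [sum_range_succ, ← ih]
    simp only [piT, cD]
    rw [tstep_succ, ← add_assoc]
    ring

omit [NeZero L] [∀ μ, NeZero (N μ)] in
/-- transporters of norm `≤ 1` give straight transporters of norm `≤ 1`. [folklore] -/
theorem norm_piT_le_one {R' : Tor (fine L N) → Fin d → ℂ} (hR' : ∀ x μ, ‖R' x μ‖ ≤ 1) (x : Tor (fine L N)) (μ : Fin d) (t : ℕ) :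
    ‖piT L N R' x μ t‖ ≤ 1 := by
  induction t with
  | zero => simp [piT]
  | succ t ih =>
    simp only [piT]
    rw [norm_mul]
    calc ‖piT L N R' x μ t‖ * ‖R' (x + tstep (fine L N) μ t) μ‖ ≤ 1 * 1 :=
          mul_le_mul ih (hR' _ _) (norm_nonneg _) zero_le_one
      _ = 1 := one_mul 1

end Telescope

/-! ## §3 The covariant difference of a transported average: exact decomposition and pointwise bound -/

section Pointwise

variable (L : ℕ) [NeZero L] (N : Fin d → ℕ) [∀ μ, NeZero (N μ)]
variable (Rc : Tor N → Fin d → ℂ) (R' : Tor (fine L N) → Fin d → ℂ) (T' : Tor (fine L N) → ℂ)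

omit [NeZero L] [∀ μ, NeZero (N μ)] in
/-- **EXACT DECOMPOSITION**: `(D_{R̄} Q_{T′}f′)(y,μ) = L^{−d}Σ_j [ T′(bpt y j)·Σ_{s<L} Π_s·(D_{R′}f′)(bpt y j + s e_μ, μ) + Mis(y,μ,j)·f′(bpt (y+e_μ) j) ]`
— the coarse covariant difference of the average is the transported average of the fine covariant differences along the straight paths,
plus the mismatch acting on the field (uses `B(y) + L e_μ = B(y + e_μ)`, tree `B5Block118.bpt_add_tstep`). [folklore] -/
theorem cD_Qc_eq (f' : Tor (fine L N) → ℂ) (y : Tor N) (μ : Fin d) :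
    cD N Rc (Qc L N T' f') y μ
      = ((L : ℂ) ^ d)⁻¹ * ∑ j : Fin d → Fin L,
          (T' (bpt L N y j) * ∑ s ∈ range L, piT L N R' (bpt L N y j) μ s * cD (fine L N) R' f' (bpt L N y j + tstep (fine L N) μ s) μ
            + mis L N Rc R' T' y μ j * f' (bpt L N (y + unitVec N μ) j)) := by
  have key : ∀ j : Fin d → Fin L,
      T' (bpt L N y j) * ∑ s ∈ range L, piT L N R' (bpt L N y j) μ s * cD (fine L N) R' f' (bpt L N y j + tstep (fine L N) μ s) μ
        + mis L N Rc R' T' y μ j * f' (bpt L N (y + unitVec N μ) j)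
      = Rc y μ * (T' (bpt L N (y + unitVec N μ) j) * f' (bpt L N (y + unitVec N μ) j)) - T' (bpt L N y j) * f' (bpt L N y j) := by
    intro j
    rw [← piT_telescope, bpt_add_tstep]
    unfold mis
    ring
  simp_rw [key]
  rw [sum_sub_distrib, ← mul_sum]
  unfold cD Qc
  ring

omit [NeZero L] in
/-- the norm of the averaging prefactor: `‖(L^d)⁻¹‖ = (L^d)⁻¹`. [folklore] -/
theorem norm_invLd : ‖((L : ℂ) ^ d)⁻¹‖ = ((L : ℝ) ^ d)⁻¹ := by
  rw [norm_inv, norm_pow, Complex.norm_natCast]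

omit [NeZero L] [∀ μ, NeZero (N μ)] in
/-- **POINTWISE BOUND** (contractions `‖R̄‖, ‖R′‖, ‖T′‖ ≤ 1`, mismatch `‖Mis‖ ≤ m`):
`|(D_{R̄} Q_{T′}f′)(y,μ)| ≤ L^{−d}Σ_j [ Σ_{s<L} |(D_{R′}f′)(bpt y j + s e_μ, μ)| + m·|f′(bpt (y+e_μ) j)| ]`. [folklore] -/
theorem norm_cD_Qc_le (hR' : ∀ x μ, ‖R' x μ‖ ≤ 1) (hT' : ∀ x, ‖T' x‖ ≤ 1) {m : ℝ}
    (hmis : ∀ y μ j, ‖mis L N Rc R' T' y μ j‖ ≤ m) (f' : Tor (fine L N) → ℂ) (y : Tor N) (μ : Fin d) :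
    ‖cD N Rc (Qc L N T' f') y μ‖
      ≤ ((L : ℝ) ^ d)⁻¹ * ∑ j : Fin d → Fin L,
          (∑ s ∈ range L, ‖cD (fine L N) R' f' (bpt L N y j + tstep (fine L N) μ s) μ‖ + m * ‖f' (bpt L N (y + unitVec N μ) j)‖) := by
  rw [cD_Qc_eq, norm_mul, norm_invLd]
  refine mul_le_mul_of_nonneg_left ((norm_sum_le _ _).trans (sum_le_sum fun j _ => ?_)) (by positivity)
  refine (norm_add_le _ _).trans (add_le_add ?_ ?_)
  · rw [norm_mul]
    calc ‖T' (bpt L N y j)‖ * ‖∑ s ∈ range L, piT L N R' (bpt L N y j) μ s * cD (fine L N) R' f' (bpt L N y j + tstep (fine L N) μ s) μ‖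
        ≤ 1 * ∑ s ∈ range L, ‖cD (fine L N) R' f' (bpt L N y j + tstep (fine L N) μ s) μ‖ := by
          refine mul_le_mul (hT' _) ((norm_sum_le _ _).trans (sum_le_sum fun s _ => ?_)) (norm_nonneg _) zero_le_one
          rw [norm_mul]
          calc ‖piT L N R' (bpt L N y j) μ s‖ * ‖cD (fine L N) R' f' (bpt L N y j + tstep (fine L N) μ s) μ‖
              ≤ 1 * ‖cD (fine L N) R' f' (bpt L N y j + tstep (fine L N) μ s) μ‖ :=
                mul_le_mul_of_nonneg_right (norm_piT_le_one L N hR' _ _ _) (norm_nonneg _)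
            _ = _ := one_mul _
      _ = _ := one_mul _
  · rw [norm_mul]
    exact mul_le_mul_of_nonneg_right (hmis y μ j) (norm_nonneg _)

end Pointwise

/-! ## §4 Summing the squares: Cauchy–Schwarz, the block bijection, translation invariance -/

section Sums

variable (L : ℕ) [NeZero L] (N : Fin d → ℕ) [∀ μ, NeZero (N μ)]

/-- `(Σ_{i∈s} a_i)² ≤ |s|·Σ a_i²` (Cauchy–Schwarz with the constant vector). [folklore] -/
theorem sq_sum_le_card_mul {ι : Type*} (s : Finset ι) (a : ι → ℝ) : (∑ i ∈ s, a i) ^ 2 ≤ s.card * ∑ i ∈ s, a i ^ 2 := by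
  have h := sum_mul_sq_le_sq_mul_sq s (fun _ => (1 : ℝ)) a
  simpa only [one_mul, one_pow, sum_const, nsmul_eq_mul, mul_one] using h

/-- the translated block sum: `Σ_y Σ_j g(bpt y j + s e_μ) = Σ_{x′} g(x′)` (block bijection + translation invariance of the fine torus
sum). [folklore] -/
theorem sum_blocks_translate (g : Tor (fine L N) → ℝ) (v : Tor (fine L N)) :
    ∑ y : Tor N, ∑ j : Fin d → Fin L, g (bpt L N y j + v) = ∑ x, g x := by
  rw [← sum_blocks_real L N (fun x => g (x + v)), sum_translate]

/-- the shifted block sum over the coarse torus: `Σ_y Σ_j g(bpt (y + e_μ) j) = Σ_{x′} g(x′)`. [folklore] -/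
theorem sum_blocks_shift (g : Tor (fine L N) → ℝ) (w : Tor N) :
    ∑ y : Tor N, ∑ j : Fin d → Fin L, g (bpt L N (y + w) j) = ∑ x, g x := by
  rw [sum_blocks_real L N g]
  exact Fintype.sum_equiv (Equiv.addRight w) _ _ (fun y => rfl)

variable (Rc : Tor N → Fin d → ℂ) (R' : Tor (fine L N) → Fin d → ℂ) (T' : Tor (fine L N) → ℂ)

/-- the main-term count: `Σ_y (Σ_j Σ_{s<L} |D′f′(bpt y j + s e_μ)|)² ≤ L^d·L·L·X_μ` — Cauchy–Schwarz over the `L^d·L` pairs `(j,s)`,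
then each fine bond is hit exactly `L` times (once per `s`). [folklore] -/
theorem sum_sq_main_le (f' : Tor (fine L N) → ℂ) (μ : Fin d) :
    ∑ y : Tor N, (∑ j : Fin d → Fin L, ∑ s ∈ range L, ‖cD (fine L N) R' f' (bpt L N y j + tstep (fine L N) μ s) μ‖) ^ 2
      ≤ (L : ℝ) ^ d * L * (L * dirU (fine L N) R' f' μ) := by
  set F : Tor N → (Fin d → Fin L) → ℕ → ℝ := fun y j s => ‖cD (fine L N) R' f' (bpt L N y j + tstep (fine L N) μ s) μ‖ with hF
  have hcard : (Finset.univ : Finset (Fin d → Fin L)).card = L ^ d := by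
    rw [Finset.card_univ, Fintype.card_fun, Fintype.card_fin, Fintype.card_fin]
  have step1 : ∀ y : Tor N, (∑ j : Fin d → Fin L, ∑ s ∈ range L, F y j s) ^ 2
      ≤ (L : ℝ) ^ d * L * ∑ j : Fin d → Fin L, ∑ s ∈ range L, F y j s ^ 2 := by
    intro y
    calc (∑ j : Fin d → Fin L, ∑ s ∈ range L, F y j s) ^ 2
        ≤ (L : ℝ) ^ d * ∑ j : Fin d → Fin L, (∑ s ∈ range L, F y j s) ^ 2 := by
          have h := sq_sum_le_card_mul Finset.univ (fun j : Fin d → Fin L => ∑ s ∈ range L, F y j s)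
          rwa [hcard, Nat.cast_pow] at h
      _ ≤ (L : ℝ) ^ d * ∑ j : Fin d → Fin L, ((L : ℝ) * ∑ s ∈ range L, F y j s ^ 2) := by
          refine mul_le_mul_of_nonneg_left (sum_le_sum fun j _ => ?_) (by positivity)
          have h := sq_sum_le_card_mul (range L) (fun s => F y j s)
          rwa [card_range] at h
      _ = (L : ℝ) ^ d * L * ∑ j : Fin d → Fin L, ∑ s ∈ range L, F y j s ^ 2 := by
          rw [← mul_sum]; ring
  have swap : (∑ y : Tor N, ∑ j : Fin d → Fin L, ∑ s ∈ range L, F y j s ^ 2)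
      = ∑ s ∈ range L, ∑ y : Tor N, ∑ j : Fin d → Fin L, F y j s ^ 2 := by
    have h1 : ∀ y : Tor N, (∑ j : Fin d → Fin L, ∑ s ∈ range L, F y j s ^ 2) = ∑ s ∈ range L, ∑ j : Fin d → Fin L, F y j s ^ 2 :=
      fun y => Finset.sum_comm
    simp_rw [h1]
    exact Finset.sum_comm
  have per_s : ∀ s ∈ range L, (∑ y : Tor N, ∑ j : Fin d → Fin L, F y j s ^ 2) = dirU (fine L N) R' f' μ := by
    intro s _
    rw [hF]
    exact sum_blocks_translate L N (fun x => ‖cD (fine L N) R' f' x μ‖ ^ 2) (tstep (fine L N) μ s)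
  calc ∑ y : Tor N, (∑ j : Fin d → Fin L, ∑ s ∈ range L, F y j s) ^ 2
      ≤ ∑ y : Tor N, (L : ℝ) ^ d * L * ∑ j : Fin d → Fin L, ∑ s ∈ range L, F y j s ^ 2 := sum_le_sum fun y _ => step1 y
    _ = (L : ℝ) ^ d * L * ∑ s ∈ range L, ∑ y : Tor N, ∑ j : Fin d → Fin L, F y j s ^ 2 := by rw [← mul_sum, swap]
    _ = (L : ℝ) ^ d * L * (L * dirU (fine L N) R' f' μ) := by rw [sum_congr rfl per_s, sum_const, card_range, nsmul_eq_mul]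

/-- the defect-term count: `Σ_y (Σ_j |f′(bpt (y+e_μ) j)|)² ≤ L^d·Y`. [folklore] -/
theorem sum_sq_defect_le (f' : Tor (fine L N) → ℂ) (μ : Fin d) :
    ∑ y : Tor N, (∑ j : Fin d → Fin L, ‖f' (bpt L N (y + unitVec N μ) j)‖) ^ 2 ≤ (L : ℝ) ^ d * ∑ x, ‖f' x‖ ^ 2 := by
  have hcard : (Finset.univ : Finset (Fin d → Fin L)).card = L ^ d := by
    rw [Finset.card_univ, Fintype.card_fun, Fintype.card_fin, Fintype.card_fin]
  refine (sum_le_sum fun y _ => sq_sum_le_card_mul _ _).trans ?_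
  rw [hcard, Nat.cast_pow, ← mul_sum, sum_blocks_shift L N (fun x => ‖f' x‖ ^ 2)]

/-- `Σ_y (A_y + m·B_y)² ≤ (√ΣA² + m√ΣB²)²` for nonnegative `m` (expand and Cauchy–Schwarz the cross term). [folklore] -/
theorem sum_sq_add_le {ι : Type*} (s : Finset ι) (A B : ι → ℝ) {m : ℝ} (hm : 0 ≤ m) :
    ∑ i ∈ s, (A i + m * B i) ^ 2 ≤ (Real.sqrt (∑ i ∈ s, A i ^ 2) + m * Real.sqrt (∑ i ∈ s, B i ^ 2)) ^ 2 := by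
  have hA : 0 ≤ ∑ i ∈ s, A i ^ 2 := sum_nonneg fun _ _ => sq_nonneg _
  have hB : 0 ≤ ∑ i ∈ s, B i ^ 2 := sum_nonneg fun _ _ => sq_nonneg _
  -- Cauchy–Schwarz `Σ A B ≤ √ΣA²·√ΣB²` (the tree's `Literature.Computability.QuantumComplexity.sum_mul_le_sqrt_mul_sqrt`, restated
  -- locally to keep the import cone inside the QFT tree)
  have hcs : ∑ i ∈ s, A i * B i ≤ Real.sqrt (∑ i ∈ s, A i ^ 2) * Real.sqrt (∑ i ∈ s, B i ^ 2) := by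
    rw [← Real.sqrt_mul (sum_nonneg fun _ _ => sq_nonneg _)]
    exact (le_abs_self _).trans (Real.abs_le_sqrt (sum_mul_sq_le_sq_mul_sq s A B))
  have expand : ∑ i ∈ s, (A i + m * B i) ^ 2 = ∑ i ∈ s, A i ^ 2 + 2 * m * ∑ i ∈ s, A i * B i + m ^ 2 * ∑ i ∈ s, B i ^ 2 := by
    rw [mul_sum, mul_sum, ← sum_add_distrib, ← sum_add_distrib]
    exact sum_congr rfl fun i _ => by ring
  rw [expand, add_sq, Real.sq_sqrt hA, mul_pow, Real.sq_sqrt hB]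
  nlinarith [mul_le_mul_of_nonneg_left hcs (by positivity : (0 : ℝ) ≤ 2 * m)]

/-- **LEAF FED⁺ (lattice units): THE COVARIANT FEDERBUSH INEQUALITY, ADDITIVE FORM**, one block step of side `L`, every torus, every
fine field `f′`, every direction `μ` — under contractive transporters and mismatch `≤ m`:
`Σ_y |(D_{R̄} Q_{T′}f′)(y,μ)|² ≤ (L^d)⁻² · ( √(L^d·L·(L·X_μ)) + m·√(L^d·Y) )²`, `X_μ = Σ|D_{R′}f′(·,μ)|²`, `Y = Σ|f′|²`.  The main term has
constant EXACTLY 1 (`= L^{2−d}X_μ`, Federbush's direction at `m = 0`); the background enters only through `m`. [folklore] -/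
theorem dirU_Qc_le_raw (hR' : ∀ x μ, ‖R' x μ‖ ≤ 1) (hT' : ∀ x, ‖T' x‖ ≤ 1) {m : ℝ} (hm : 0 ≤ m)
    (hmis : ∀ y μ j, ‖mis L N Rc R' T' y μ j‖ ≤ m) (f' : Tor (fine L N) → ℂ) (μ : Fin d) :
    dirU N Rc (Qc L N T' f') μ
      ≤ (((L : ℝ) ^ d)⁻¹) ^ 2 *
          (Real.sqrt ((L : ℝ) ^ d * L * (L * dirU (fine L N) R' f' μ)) + m * Real.sqrt ((L : ℝ) ^ d * ∑ x, ‖f' x‖ ^ 2)) ^ 2 := by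
  -- the two nonnegative block functionals
  let A : Tor N → ℝ := fun y => ∑ j : Fin d → Fin L, ∑ s ∈ range L, ‖cD (fine L N) R' f' (bpt L N y j + tstep (fine L N) μ s) μ‖
  let B : Tor N → ℝ := fun y => ∑ j : Fin d → Fin L, ‖f' (bpt L N (y + unitVec N μ) j)‖
  -- pointwise: ‖D Q f′‖ ≤ (L^d)⁻¹ (A y + m B y)
  have hpt : ∀ y, ‖cD N Rc (Qc L N T' f') y μ‖ ≤ ((L : ℝ) ^ d)⁻¹ * (A y + m * B y) := by
    intro y
    have h := norm_cD_Qc_le L N Rc R' T' hR' hT' hmis f' y μ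
    rw [sum_add_distrib, ← mul_sum] at h
    exact h
  have hsq : ∀ y, ‖cD N Rc (Qc L N T' f') y μ‖ ^ 2 ≤ (((L : ℝ) ^ d)⁻¹) ^ 2 * (A y + m * B y) ^ 2 := by
    intro y
    rw [← mul_pow]
    exact pow_le_pow_left₀ (norm_nonneg _) (hpt y) 2
  have h1 : Real.sqrt (∑ y, A y ^ 2) ≤ Real.sqrt ((L : ℝ) ^ d * L * (L * dirU (fine L N) R' f' μ)) :=
    Real.sqrt_le_sqrt (sum_sq_main_le L N R' f' μ)
  have h2 : Real.sqrt (∑ y, B y ^ 2) ≤ Real.sqrt ((L : ℝ) ^ d * ∑ x, ‖f' x‖ ^ 2) :=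
    Real.sqrt_le_sqrt (sum_sq_defect_le L N f' μ)
  have hl : 0 ≤ Real.sqrt (∑ y, A y ^ 2) + m * Real.sqrt (∑ y, B y ^ 2) := by positivity
  unfold dirU
  calc ∑ y, ‖cD N Rc (Qc L N T' f') y μ‖ ^ 2
      ≤ ∑ y, (((L : ℝ) ^ d)⁻¹) ^ 2 * (A y + m * B y) ^ 2 := sum_le_sum fun y _ => hsq y
    _ = (((L : ℝ) ^ d)⁻¹) ^ 2 * ∑ y, (A y + m * B y) ^ 2 := by rw [mul_sum]
    _ ≤ (((L : ℝ) ^ d)⁻¹) ^ 2 * (Real.sqrt (∑ y, A y ^ 2) + m * Real.sqrt (∑ y, B y ^ 2)) ^ 2 :=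
        mul_le_mul_of_nonneg_left (sum_sq_add_le _ A B hm) (by positivity)
    _ ≤ (((L : ℝ) ^ d)⁻¹) ^ 2 *
          (Real.sqrt ((L : ℝ) ^ d * L * (L * dirU (fine L N) R' f' μ)) + m * Real.sqrt ((L : ℝ) ^ d * ∑ x, ‖f' x‖ ^ 2)) ^ 2 :=
        mul_le_mul_of_nonneg_left (pow_le_pow_left₀ hl (add_le_add h1 (mul_le_mul_of_nonneg_left h2 hm)) 2) (by positivity)

/-- `(L^d)⁻¹·√(L^d·Z) = √(Z/L^d)` and `(L^d)⁻¹·√(L^d·L·(L·Z)) = √(L²·Z/L^d)` — moving the averaging prefactor inside the roots. [folklore] -/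
theorem invLd_mul_sqrt (Z : ℝ) :
    ((L : ℝ) ^ d)⁻¹ * Real.sqrt ((L : ℝ) ^ d * Z) = Real.sqrt (Z / (L : ℝ) ^ d) ∧
      ((L : ℝ) ^ d)⁻¹ * Real.sqrt ((L : ℝ) ^ d * L * (L * Z)) = Real.sqrt ((L : ℝ) ^ 2 * Z / (L : ℝ) ^ d) := by
  have hL : (0 : ℝ) < (L : ℝ) ^ d := by have := NeZero.ne L; positivity
  have hc : 0 ≤ ((L : ℝ) ^ d)⁻¹ := by positivity
  have key : ∀ W : ℝ, ((L : ℝ) ^ d)⁻¹ * Real.sqrt W = Real.sqrt ((((L : ℝ) ^ d)⁻¹) ^ 2 * W) := fun W => by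
    rw [Real.sqrt_mul (sq_nonneg _), Real.sqrt_sq hc]
  refine ⟨?_, ?_⟩
  · rw [key]; congr 1; field_simp
  · rw [key]; congr 1; field_simp

/-- **LEAF FED⁺ (lattice units, clean form)**: `Σ_y |(D_{R̄} Q_{T′}f′)(y,μ)|² ≤ ( √(L²·X_μ/L^d) + m·√(Y/L^d) )²`. [folklore] -/
theorem dirU_Qc_le (hR' : ∀ x μ, ‖R' x μ‖ ≤ 1) (hT' : ∀ x, ‖T' x‖ ≤ 1) {m : ℝ} (hm : 0 ≤ m)
    (hmis : ∀ y μ j, ‖mis L N Rc R' T' y μ j‖ ≤ m) (f' : Tor (fine L N) → ℂ) (μ : Fin d) :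
    dirU N Rc (Qc L N T' f') μ
      ≤ (Real.sqrt ((L : ℝ) ^ 2 * dirU (fine L N) R' f' μ / (L : ℝ) ^ d) + m * Real.sqrt ((∑ x, ‖f' x‖ ^ 2) / (L : ℝ) ^ d)) ^ 2 := by
  have h := dirU_Qc_le_raw L N Rc R' T' hR' hT' hm hmis f' μ
  obtain ⟨e1, e2⟩ := invLd_mul_sqrt L (d := d) (∑ x, ‖f' x‖ ^ 2)
  obtain ⟨-, e3⟩ := invLd_mul_sqrt L (d := d) (dirU (fine L N) R' f' μ)
  rw [← e1, ← e3]
  calc dirU N Rc (Qc L N T' f') μ ≤ _ := h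
    _ = (((L : ℝ) ^ d)⁻¹ * Real.sqrt ((L : ℝ) ^ d * L * (L * dirU (fine L N) R' f' μ))
          + m * (((L : ℝ) ^ d)⁻¹ * Real.sqrt ((L : ℝ) ^ d * ∑ x, ‖f' x‖ ^ 2))) ^ 2 := by ring

/-- `Σ_μ (a_μ + b)² ≤ (√(Σ_μ a_μ²) + √d·b)²` on `Fin d` for `b ≥ 0` (Cauchy–Schwarz on the cross term). [folklore] -/
theorem sum_fin_sq_add_le (a : Fin d → ℝ) {b : ℝ} (hb : 0 ≤ b) :
    ∑ μ, (a μ + b) ^ 2 ≤ (Real.sqrt (∑ μ, a μ ^ 2) + Real.sqrt d * b) ^ 2 := by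
  have hA : 0 ≤ ∑ μ, a μ ^ 2 := sum_nonneg fun _ _ => sq_nonneg _
  have hcs : ∑ μ, a μ ≤ Real.sqrt d * Real.sqrt (∑ μ, a μ ^ 2) := by
    have h : ∑ μ : Fin d, (1 : ℝ) * a μ ≤ Real.sqrt (∑ μ : Fin d, (1 : ℝ) ^ 2) * Real.sqrt (∑ μ, a μ ^ 2) := by
      rw [← Real.sqrt_mul (sum_nonneg fun _ _ => sq_nonneg _)]
      exact (le_abs_self _).trans (Real.abs_le_sqrt (sum_mul_sq_le_sq_mul_sq _ _ a))
    simp only [one_mul, one_pow, sum_const, Finset.card_univ, Fintype.card_fin, nsmul_eq_mul, mul_one] at h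
    exact h
  have expand : ∑ μ, (a μ + b) ^ 2 = ∑ μ, a μ ^ 2 + 2 * b * ∑ μ, a μ + d * b ^ 2 := by
    have : ∀ μ : Fin d, (a μ + b) ^ 2 = a μ ^ 2 + (2 * b * a μ + b ^ 2) := fun μ => by ring
    simp_rw [this]
    rw [sum_add_distrib, sum_add_distrib, ← mul_sum, sum_const, Finset.card_univ, Fintype.card_fin, nsmul_eq_mul]
    ring
  have hd : Real.sqrt (d : ℝ) ^ 2 = d := Real.sq_sqrt (Nat.cast_nonneg d)
  rw [expand, add_sq, Real.sq_sqrt hA, mul_pow, hd]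
  nlinarith [mul_le_mul_of_nonneg_left hcs (by positivity : (0 : ℝ) ≤ 2 * b), Real.sqrt_nonneg (d : ℝ),
    Real.sqrt_nonneg (∑ μ, a μ ^ 2)]

/-- **LEAF FED⁺ SUMMED OVER DIRECTIONS** (the covariant Dirichlet form of the transported average against the fine one):
`Σ_μ Σ_y |(D_{R̄} Q_{T′}f′)(y,μ)|² ≤ ( √(L²·Σ_μ X_μ/L^d) + √d·m·√(Y/L^d) )²`.  In physical units at level `n = L^k` (multiply by
`n^{2−d}`): `Sc(Q_{T′}f′) ≤ (√Sf(f′) + √d·(n m)·‖f′‖_{L²})²` — the `federbush` field of `VariationalPairShape.PairDefects` at the fine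
minimiser with `e·‖B‖² = 2√d(nm)√(Sf)‖f′‖ + d(nm)²‖f′‖²`. [folklore] -/
theorem sum_dirU_Qc_le (hR' : ∀ x μ, ‖R' x μ‖ ≤ 1) (hT' : ∀ x, ‖T' x‖ ≤ 1) {m : ℝ} (hm : 0 ≤ m)
    (hmis : ∀ y μ j, ‖mis L N Rc R' T' y μ j‖ ≤ m) (f' : Tor (fine L N) → ℂ) :
    ∑ μ, dirU N Rc (Qc L N T' f') μ
      ≤ (Real.sqrt ((L : ℝ) ^ 2 * (∑ μ, dirU (fine L N) R' f' μ) / (L : ℝ) ^ d)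
          + Real.sqrt d * (m * Real.sqrt ((∑ x, ‖f' x‖ ^ 2) / (L : ℝ) ^ d))) ^ 2 := by
  have hL : (0 : ℝ) < (L : ℝ) ^ d := by have := NeZero.ne L; positivity
  set a : Fin d → ℝ := fun μ => Real.sqrt ((L : ℝ) ^ 2 * dirU (fine L N) R' f' μ / (L : ℝ) ^ d) with ha
  set b : ℝ := m * Real.sqrt ((∑ x, ‖f' x‖ ^ 2) / (L : ℝ) ^ d) with hb
  have hb0 : 0 ≤ b := by positivity
  have hsum : ∑ μ, a μ ^ 2 = (L : ℝ) ^ 2 * (∑ μ, dirU (fine L N) R' f' μ) / (L : ℝ) ^ d := by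
    simp only [ha]
    rw [mul_sum, sum_div]
    refine sum_congr rfl fun μ _ => Real.sq_sqrt ?_
    exact div_nonneg (mul_nonneg (sq_nonneg _) (dirU_nonneg _ _ _ _)) hL.le
  calc ∑ μ, dirU N Rc (Qc L N T' f') μ ≤ ∑ μ, (a μ + b) ^ 2 :=
        sum_le_sum fun μ _ => dirU_Qc_le L N Rc R' T' hR' hT' hm hmis f' μ
    _ ≤ (Real.sqrt (∑ μ, a μ ^ 2) + Real.sqrt d * b) ^ 2 := sum_fin_sq_add_le a hb0
    _ = _ := by rw [hsum]


end Sums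

end Summit.QuantumFields.BalabanUV.T4Continuum.VariationalCovariantFederbush

end
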